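import Mathlib
import Literature.Probability.LatticeModels.GKSInequalities
import Summits.CriticalPhenomena.Ising3DConformalLimit.Theorems.PrecisionLaplacianInverseMFerromagnetImNonadjOfLaw2Aux
import Summits.CriticalPhenomena.Ising3DConformalLimit.Theorems.PrecisionLaplacianInverseMFerromagnetDbDeg2Eq
import HarnessLib

/-!
# Crux `PrecisionLaplacian.InverseMFerromagnet` (stmt-CriticalPhenomena-4798), line `Sketch` —
# stub `helper_K23_precision`, auxiliaries (theta-law anchor Θ1: the `K₂,₃` hub–hub precision)

THEOREM-ONLY helper file (no definitions).  The `K₂,₃` pair ferromagnet: sites `Fin 5` (hubs `0, 1`,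
middle sites `Fin.natAdd 2 j`), bonds `Fin 3 ⊕ Fin 3` (`inl j = {0, mid j}` coupling `b j`,
`inr j = {1, mid j}` coupling `c j`), Hamiltonian `H = ∑_j (b_j σ₀ + c_j σ₁) σ_{mid j}` (`k23_ham`).
* `k23_callen`: Callen's identity at a middle site, linearised (`c2_integrate` + `d6_tanh_two_spins`):
  `⟨σ_{mid i} F⟩ = α_i ⟨σ₀F⟩ + β_i ⟨σ₁F⟩`, `α_i, β_i = (tanh(b_i+c_i) ± tanh(b_i−c_i))/2`.
* `k23_rho`: summing out the middle spins (`k23_decimate`, three flips `k23_avg`) and the series rule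
  `cosh(b s₀ + c s₁) = (cosh b cosh c / cosh a) e^{s₀s₁a}` (`k23_cosh_branch`, `tanh a = tanh b tanh c`):
  `⟨σ₀σ₁⟩ = tanh (∑ a_i)`.
* scalar identities `k23_alpha_beta` (`αβ(1+t²) = t(1−α²−β²)`, `t = tanh b tanh c`) and `k23_branch`
  (`t/(1+t²−2ρt) = ½cosh A sinh A − ½cosh²A tanh(A−2a)` for `t = tanh a`, `ρ = tanh A`), both proved as
  rational identities in `e^a, e^b, e^c, e^A` (`d6_tanh_eq_exp_sq`).
-/

namespace Summit.CriticalPhenomena.Ising3DConformalLimit.Cruxes.InverseMFerromagnet.PartialCovarianceLadder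

open Literature.Probability.LatticeModels Finset Matrix

noncomputable section

/-! ## Scalar identities -/

/-- With `α = (tanh(b+c) + tanh(b−c))/2`, `β = (tanh(b+c) − tanh(b−c))/2`, `t = tanh b · tanh c`:
`αβ(1 + t²) = t(1 − α² − β²)`. [folklore] -/
theorem k23_alpha_beta (b c α β : ℝ)
    (hα : α = (Real.tanh (b + c) + Real.tanh (b - c)) / 2)
    (hβ : β = (Real.tanh (b + c) - Real.tanh (b - c)) / 2) :
    α * β * (1 + (Real.tanh b * Real.tanh c) ^ 2)
      = Real.tanh b * Real.tanh c * (1 - α ^ 2 - β ^ 2) := by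
  have hP : 0 < Real.exp b := Real.exp_pos b
  have hQ : 0 < Real.exp c := Real.exp_pos c
  rw [hα, hβ, d6_tanh_eq_exp_sq (b + c), d6_tanh_eq_exp_sq (b - c), d6_tanh_eq_exp_sq b,
    d6_tanh_eq_exp_sq c, Real.exp_add, Real.exp_sub]
  have h1 : (Real.exp b * Real.exp c) ^ 2 + 1 ≠ 0 := by positivity
  have h2 : (Real.exp b / Real.exp c) ^ 2 + 1 ≠ 0 := by positivity
  have h3 : Real.exp b ^ 2 + 1 ≠ 0 := by positivity
  have h4 : Real.exp c ^ 2 + 1 ≠ 0 := by positivity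
  field_simp
  ring

/-- Per-branch closed form: with `t = tanh a`, `ρ = tanh A`,
`t/(1 + t² − 2ρt) = ½ cosh A sinh A − ½ cosh²A · tanh(A − 2a)`. [folklore] -/
theorem k23_branch (a A : ℝ) :
    Real.tanh a / (1 + Real.tanh a ^ 2 - 2 * Real.tanh A * Real.tanh a)
      = 1 / 2 * Real.cosh A * Real.sinh A - 1 / 2 * Real.cosh A ^ 2 * Real.tanh (A - 2 * a) := by
  have hD : 1 + Real.tanh a ^ 2 - 2 * Real.tanh A * Real.tanh a ≠ 0 := by
    have h1 := Real.tanh_sq_lt_one A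
    have h2 : 1 + Real.tanh a ^ 2 - 2 * Real.tanh A * Real.tanh a
        = (Real.tanh a - Real.tanh A) ^ 2 + (1 - Real.tanh A ^ 2) := by ring
    rw [h2]
    positivity
  rw [div_eq_iff hD]
  have hP : 0 < Real.exp a := Real.exp_pos a
  have hR : 0 < Real.exp A := Real.exp_pos A
  rw [d6_tanh_eq_exp_sq a, d6_tanh_eq_exp_sq A, d6_tanh_eq_exp_sq (A - 2 * a), Real.cosh_eq,
    Real.sinh_eq, Real.exp_sub, Real.exp_neg, show (2 : ℝ) * a = a + a by ring, Real.exp_add]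
  have h1 : Real.exp a ^ 2 + 1 ≠ 0 := by positivity
  have h2 : Real.exp A ^ 2 + 1 ≠ 0 := by positivity
  have h3 : (Real.exp A / (Real.exp a * Real.exp a)) ^ 2 + 1 ≠ 0 := by positivity
  field_simp
  ring

/-- The effective bond of one branch: if `tanh a = tanh b · tanh c` then for `s₀, s₁ = ±1`,
`cosh(b s₀ + c s₁) = (cosh b cosh c / cosh a) · e^{s₀ s₁ a}`. [folklore] -/
theorem k23_cosh_branch {a b c : ℝ} (h : Real.tanh a = Real.tanh b * Real.tanh c) (s₀ s₁ : ℝ)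
    (hs₀ : s₀ = 1 ∨ s₀ = -1) (hs₁ : s₁ = 1 ∨ s₁ = -1) :
    Real.cosh (b * s₀ + c * s₁)
      = Real.cosh b * Real.cosh c / Real.cosh a * Real.exp (s₀ * s₁ * a) := by
  have ha : Real.cosh a ≠ 0 := (Real.cosh_pos a).ne'
  have hb : Real.cosh b ≠ 0 := (Real.cosh_pos b).ne'
  have hc : Real.cosh c ≠ 0 := (Real.cosh_pos c).ne'
  have key : Real.sinh a * (Real.cosh b * Real.cosh c) = Real.sinh b * Real.sinh c * Real.cosh a := by
    rw [Real.tanh_eq_sinh_div_cosh, Real.tanh_eq_sinh_div_cosh, Real.tanh_eq_sinh_div_cosh,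
      div_mul_div_comm, div_eq_div_iff ha (mul_ne_zero hb hc)] at h
    exact h
  rw [div_mul_eq_mul_div, eq_div_iff ha]
  rcases hs₀ with rfl | rfl <;> rcases hs₁ with rfl | rfl
  · rw [show b * 1 + c * 1 = b + c by ring, show (1 : ℝ) * 1 * a = a by ring, Real.cosh_add,
      ← Real.cosh_add_sinh]
    linear_combination -key
  · rw [show b * 1 + c * -1 = b - c by ring, show (1 : ℝ) * -1 * a = -a by ring, Real.cosh_sub,
      ← Real.cosh_sub_sinh]
    linear_combination key
  · rw [show b * -1 + c * 1 = -(b - c) by ring, show (-1 : ℝ) * 1 * a = -a by ring, Real.cosh_neg,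
      Real.cosh_sub, ← Real.cosh_sub_sinh]
    linear_combination key
  · rw [show b * -1 + c * -1 = -(b + c) by ring, show (-1 : ℝ) * -1 * a = a by ring, Real.cosh_neg,
      Real.cosh_add, ← Real.cosh_add_sinh]
    linear_combination -key

/-! ## The `K₂,₃` model: Hamiltonian, summing out a spin, Callen's identity -/

/-- Middle sites are not the hub `0`. [folklore] -/
theorem k23_mid_ne_zero (j : Fin 3) : (Fin.natAdd 2 j : Fin 5) ≠ 0 := by
  intro h
  have h' := congrArg Fin.val h
  simp only [Fin.val_natAdd, Fin.val_zero] at h'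
  omega

/-- Middle sites are not the hub `1`. [folklore] -/
theorem k23_mid_ne_one (j : Fin 3) : (Fin.natAdd 2 j : Fin 5) ≠ 1 := by
  intro h
  have h' := congrArg Fin.val h
  simp only [Fin.val_natAdd, Fin.val_one] at h'
  omega

/-- The `K₂,₃` Hamiltonian: `H(ω) = ∑_j (b_j σ₀ + c_j σ₁) σ_{2+j}`. [folklore] -/
theorem k23_ham (b c : Fin 3 → ℝ) (ω : SpinConfig (Fin 5)) :
    gksHamiltonian Finset.univ (Sum.elim b c)
        (Sum.elim (fun i : Fin 3 => ({0, Fin.natAdd 2 i} : Finset (Fin 5)))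
          (fun i : Fin 3 => ({1, Fin.natAdd 2 i} : Finset (Fin 5)))) ω
      = ∑ j : Fin 3, (b j * spinAt 0 ω + c j * spinAt 1 ω) * spinAt (Fin.natAdd 2 j) ω := by
  unfold gksHamiltonian
  rw [Fintype.sum_sum_type]
  simp only [Sum.elim_inl, Sum.elim_inr, spinProduct]
  rw [← Finset.sum_add_distrib]
  refine Finset.sum_congr rfl fun j _ => ?_
  rw [Finset.prod_pair (k23_mid_ne_zero j).symm, Finset.prod_pair (k23_mid_ne_one j).symm]
  ring

/-- Summing out one `±1` spin: `∑_ω g e^{h σ_x} = ∑_ω g cosh h` for `g`, `h` independent of `σ_x`.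
[folklore] -/
theorem k23_avg (x : Fin 5) (g h : SpinConfig (Fin 5) → ℝ)
    (hg : ∀ ω, g (ω * Pi.mulSingle x (-1)) = g ω) (hh : ∀ ω, h (ω * Pi.mulSingle x (-1)) = h ω) :
    ∑ ω, g ω * Real.exp (h ω * spinAt x ω) = ∑ ω, g ω * Real.cosh (h ω) := by
  rw [← sub_eq_zero, ← Finset.sum_sub_distrib]
  refine c2_sum_flip_zero x _ fun ω => ?_
  rw [hg, hh, pcm2im_spinAt_flip_same, Real.cosh_eq]
  rcases spinAt_eq_one_or_eq_neg_one x ω with h1 | h1 <;> rw [h1] <;>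
    simp only [mul_one, mul_neg_one, neg_neg] <;> ring

/-- Summing out the three middle spins: for `f` independent of them,
`∑_ω f e^{H} = ∑_ω f ∏_j cosh(b_j σ₀ + c_j σ₁)`. [folklore] -/
theorem k23_decimate (b c : Fin 3 → ℝ) (f : SpinConfig (Fin 5) → ℝ)
    (hf : ∀ (j : Fin 3) (ω : SpinConfig (Fin 5)), f (ω * Pi.mulSingle (Fin.natAdd 2 j) (-1)) = f ω) :
    gksSum Finset.univ (Sum.elim b c)
        (Sum.elim (fun i : Fin 3 => ({0, Fin.natAdd 2 i} : Finset (Fin 5)))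
          (fun i : Fin 3 => ({1, Fin.natAdd 2 i} : Finset (Fin 5)))) f
      = ∑ ω, f ω * (Real.cosh (b 0 * spinAt 0 ω + c 0 * spinAt 1 ω)
          * Real.cosh (b 1 * spinAt 0 ω + c 1 * spinAt 1 ω)
          * Real.cosh (b 2 * spinAt 0 ω + c 2 * spinAt 1 ω)) := by
  have h0 : ∀ (j : Fin 3) (ω : SpinConfig (Fin 5)),
      spinAt 0 (ω * Pi.mulSingle (Fin.natAdd 2 j) (-1)) = spinAt 0 ω :=
    fun j ω => pcm2im_spinAt_flip_ne (k23_mid_ne_zero j).symm ω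
  have h1 : ∀ (j : Fin 3) (ω : SpinConfig (Fin 5)),
      spinAt 1 (ω * Pi.mulSingle (Fin.natAdd 2 j) (-1)) = spinAt 1 ω :=
    fun j ω => pcm2im_spinAt_flip_ne (k23_mid_ne_one j).symm ω
  have hm : ∀ i j : Fin 3, i ≠ j → ∀ ω : SpinConfig (Fin 5),
      spinAt (Fin.natAdd 2 i) (ω * Pi.mulSingle (Fin.natAdd 2 j) (-1)) = spinAt (Fin.natAdd 2 i) ω :=
    fun i j hij ω => pcm2im_spinAt_flip_ne (fun h => hij ((Fin.natAdd_inj 2).1 h)) ω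
  unfold gksSum gksWeight
  simp_rw [k23_ham, Fin.sum_univ_three, Real.exp_add]
  calc ∑ ω, f ω * (Real.exp ((b 0 * spinAt 0 ω + c 0 * spinAt 1 ω) * spinAt (Fin.natAdd 2 (0 : Fin 3)) ω)
          * Real.exp ((b 1 * spinAt 0 ω + c 1 * spinAt 1 ω) * spinAt (Fin.natAdd 2 (1 : Fin 3)) ω)
          * Real.exp ((b 2 * spinAt 0 ω + c 2 * spinAt 1 ω) * spinAt (Fin.natAdd 2 (2 : Fin 3)) ω))
      = ∑ ω, (f ω * Real.exp ((b 1 * spinAt 0 ω + c 1 * spinAt 1 ω) * spinAt (Fin.natAdd 2 (1 : Fin 3)) ω)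
          * Real.exp ((b 2 * spinAt 0 ω + c 2 * spinAt 1 ω) * spinAt (Fin.natAdd 2 (2 : Fin 3)) ω))
          * Real.exp ((b 0 * spinAt 0 ω + c 0 * spinAt 1 ω) * spinAt (Fin.natAdd 2 (0 : Fin 3)) ω) :=
        Finset.sum_congr rfl fun ω _ => by ring
    _ = ∑ ω, (f ω * Real.exp ((b 1 * spinAt 0 ω + c 1 * spinAt 1 ω) * spinAt (Fin.natAdd 2 (1 : Fin 3)) ω)
          * Real.exp ((b 2 * spinAt 0 ω + c 2 * spinAt 1 ω) * spinAt (Fin.natAdd 2 (2 : Fin 3)) ω))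
          * Real.cosh (b 0 * spinAt 0 ω + c 0 * spinAt 1 ω) :=
        k23_avg (Fin.natAdd 2 (0 : Fin 3)) _ _
          (fun ω => by simp only [hf, h0, h1, hm 1 0 (by decide), hm 2 0 (by decide)])
          (fun ω => by simp only [h0, h1])
    _ = ∑ ω, (f ω * Real.cosh (b 0 * spinAt 0 ω + c 0 * spinAt 1 ω)
          * Real.exp ((b 2 * spinAt 0 ω + c 2 * spinAt 1 ω) * spinAt (Fin.natAdd 2 (2 : Fin 3)) ω))
          * Real.exp ((b 1 * spinAt 0 ω + c 1 * spinAt 1 ω) * spinAt (Fin.natAdd 2 (1 : Fin 3)) ω) :=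
        Finset.sum_congr rfl fun ω _ => by ring
    _ = ∑ ω, (f ω * Real.cosh (b 0 * spinAt 0 ω + c 0 * spinAt 1 ω)
          * Real.exp ((b 2 * spinAt 0 ω + c 2 * spinAt 1 ω) * spinAt (Fin.natAdd 2 (2 : Fin 3)) ω))
          * Real.cosh (b 1 * spinAt 0 ω + c 1 * spinAt 1 ω) :=
        k23_avg (Fin.natAdd 2 (1 : Fin 3)) _ _
          (fun ω => by simp only [hf, h0, h1, hm 2 1 (by decide)])
          (fun ω => by simp only [h0, h1])
    _ = ∑ ω, (f ω * Real.cosh (b 0 * spinAt 0 ω + c 0 * spinAt 1 ω)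
          * Real.cosh (b 1 * spinAt 0 ω + c 1 * spinAt 1 ω))
          * Real.exp ((b 2 * spinAt 0 ω + c 2 * spinAt 1 ω) * spinAt (Fin.natAdd 2 (2 : Fin 3)) ω) :=
        Finset.sum_congr rfl fun ω _ => by ring
    _ = ∑ ω, (f ω * Real.cosh (b 0 * spinAt 0 ω + c 0 * spinAt 1 ω)
          * Real.cosh (b 1 * spinAt 0 ω + c 1 * spinAt 1 ω))
          * Real.cosh (b 2 * spinAt 0 ω + c 2 * spinAt 1 ω) :=
        k23_avg (Fin.natAdd 2 (2 : Fin 3)) _ _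
          (fun ω => by simp only [hf, h0, h1])
          (fun ω => by simp only [h0, h1])
    _ = _ := Finset.sum_congr rfl fun ω _ => by ring

/-- **Callen's identity at a middle site, linearised:** for `F` independent of `σ_{2+i}`,
`⟨σ_{2+i} F⟩ = α_i ⟨σ₀ F⟩ + β_i ⟨σ₁ F⟩` with `α_i = (tanh(b_i+c_i) + tanh(b_i−c_i))/2`,
`β_i = (tanh(b_i+c_i) − tanh(b_i−c_i))/2`. [folklore] -/
theorem k23_callen (b c : Fin 3 → ℝ) (i : Fin 3) (F : SpinConfig (Fin 5) → ℝ)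
    (hF : ∀ ω, F (ω * Pi.mulSingle (Fin.natAdd 2 i) (-1)) = F ω) :
    gksExpect Finset.univ (Sum.elim b c)
        (Sum.elim (fun i : Fin 3 => ({0, Fin.natAdd 2 i} : Finset (Fin 5)))
          (fun i : Fin 3 => ({1, Fin.natAdd 2 i} : Finset (Fin 5))))
        (fun ω => spinAt (Fin.natAdd 2 i) ω * F ω)
      = (Real.tanh (b i + c i) + Real.tanh (b i - c i)) / 2
          * gksExpect Finset.univ (Sum.elim b c)
              (Sum.elim (fun i : Fin 3 => ({0, Fin.natAdd 2 i} : Finset (Fin 5)))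
                (fun i : Fin 3 => ({1, Fin.natAdd 2 i} : Finset (Fin 5))))
              (fun ω => spinAt 0 ω * F ω)
        + (Real.tanh (b i + c i) - Real.tanh (b i - c i)) / 2
          * gksExpect Finset.univ (Sum.elim b c)
              (Sum.elim (fun i : Fin 3 => ({0, Fin.natAdd 2 i} : Finset (Fin 5)))
                (fun i : Fin 3 => ({1, Fin.natAdd 2 i} : Finset (Fin 5))))
              (fun ω => spinAt 1 ω * F ω) := by
  have hH : ∀ ω : SpinConfig (Fin 5), gksHamiltonian Finset.univ (Sum.elim b c)
      (Sum.elim (fun i : Fin 3 => ({0, Fin.natAdd 2 i} : Finset (Fin 5)))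
        (fun i : Fin 3 => ({1, Fin.natAdd 2 i} : Finset (Fin 5)))) ω
      = gksHamiltonian Finset.univ (Sum.elim (Function.update b i 0) (Function.update c i 0))
          (Sum.elim (fun i : Fin 3 => ({0, Fin.natAdd 2 i} : Finset (Fin 5)))
            (fun i : Fin 3 => ({1, Fin.natAdd 2 i} : Finset (Fin 5)))) ω
        + spinAt (Fin.natAdd 2 i) ω * (b i * spinAt 0 ω + c i * spinAt 1 ω) := by
    intro ω
    rw [k23_ham, k23_ham]
    have e : ∀ j : Fin 3, (Function.update b i 0 j * spinAt 0 ω + Function.update c i 0 j * spinAt 1 ω)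
          * spinAt (Fin.natAdd 2 j) ω
        = (b j * spinAt 0 ω + c j * spinAt 1 ω) * spinAt (Fin.natAdd 2 j) ω
          - if j = i then (b i * spinAt 0 ω + c i * spinAt 1 ω) * spinAt (Fin.natAdd 2 i) ω else 0 := by
      intro j
      by_cases hj : j = i
      · subst hj
        simp
      · simp [hj]
    simp_rw [e]
    rw [Finset.sum_sub_distrib, Finset.sum_ite_eq' Finset.univ i, if_pos (Finset.mem_univ i)]
    ring
  have hK' : ∀ k ∈ (Finset.univ : Finset (Fin 3 ⊕ Fin 3)),
      Fin.natAdd 2 i ∈ Sum.elim (fun i : Fin 3 => ({0, Fin.natAdd 2 i} : Finset (Fin 5)))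
        (fun i : Fin 3 => ({1, Fin.natAdd 2 i} : Finset (Fin 5))) k →
      Sum.elim (Function.update b i 0) (Function.update c i 0) k = 0 := by
    rintro (j | j) - hj
    · simp only [Sum.elim_inl, Finset.mem_insert, Finset.mem_singleton] at hj
      rcases hj with h | h
      · exact absurd h (k23_mid_ne_zero i)
      · rw [Fin.natAdd_inj] at h
        subst h
        simp
    · simp only [Sum.elim_inr, Finset.mem_insert, Finset.mem_singleton] at hj
      rcases hj with h | h
      · exact absurd h (k23_mid_ne_one i)
      · rw [Fin.natAdd_inj] at h
        subst h
        simp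
  have hh : ∀ ω : SpinConfig (Fin 5),
      b i * spinAt 0 (ω * Pi.mulSingle (Fin.natAdd 2 i) (-1))
          + c i * spinAt 1 (ω * Pi.mulSingle (Fin.natAdd 2 i) (-1))
        = b i * spinAt 0 ω + c i * spinAt 1 ω := fun ω => by
    rw [pcm2im_spinAt_flip_ne (k23_mid_ne_zero i).symm, pcm2im_spinAt_flip_ne (k23_mid_ne_one i).symm]
  rw [(c2_integrate Finset.univ _ _ _ (Fin.natAdd 2 i) (fun ω => b i * spinAt 0 ω + c i * spinAt 1 ω)
    hH hK' hh F hF).1]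
  have e2 : (fun ω : SpinConfig (Fin 5) => Real.tanh (b i * spinAt 0 ω + c i * spinAt 1 ω) * F ω)
      = fun ω => (Real.tanh (b i + c i) + Real.tanh (b i - c i)) / 2 * (spinAt 0 ω * F ω)
          + (Real.tanh (b i + c i) - Real.tanh (b i - c i)) / 2 * (spinAt 1 ω * F ω) := by
    funext ω
    rw [d6_tanh_two_spins (b i) (c i) _ _ (spinAt_eq_one_or_eq_neg_one 0 ω)
      (spinAt_eq_one_or_eq_neg_one 1 ω)]
    ring
  rw [e2, d6_gksExpect_lin]

/-- **Three branches in parallel, each two bonds in series:** `⟨σ₀σ₁⟩ = tanh (∑ a_i)` when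
`tanh a_i = tanh b_i · tanh c_i`. [folklore] -/
theorem k23_rho (b c a : Fin 3 → ℝ) (habc : ∀ i, Real.tanh (a i) = Real.tanh (b i) * Real.tanh (c i)) :
    gksExpect Finset.univ (Sum.elim b c)
        (Sum.elim (fun i : Fin 3 => ({0, Fin.natAdd 2 i} : Finset (Fin 5)))
          (fun i : Fin 3 => ({1, Fin.natAdd 2 i} : Finset (Fin 5))))
        (fun ω => spinAt 0 ω * spinAt 1 ω) = Real.tanh (∑ i, a i) := by
  have hZ := gksSum_one_pos Finset.univ (Sum.elim b c)
    (Sum.elim (fun i : Fin 3 => ({0, Fin.natAdd 2 i} : Finset (Fin 5)))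
      (fun i : Fin 3 => ({1, Fin.natAdd 2 i} : Finset (Fin 5))))
  unfold gksExpect
  rw [div_eq_iff hZ.ne', ← sub_eq_zero]
  have hlin : ∀ (s : Finset (Fin 3 ⊕ Fin 3)) (K : Fin 3 ⊕ Fin 3 → ℝ) (C : Fin 3 ⊕ Fin 3 → Finset (Fin 5))
      (T : ℝ), gksSum s K C (fun ω => spinAt 0 ω * spinAt 1 ω) - T * gksSum s K C (fun _ => 1)
        = gksSum s K C (fun ω => spinAt 0 ω * spinAt 1 ω - T) := by
    intro s K C T
    simp only [gksSum, sub_mul, one_mul, Finset.sum_sub_distrib, Finset.mul_sum]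
  have h0 : ∀ (j : Fin 3) (ω : SpinConfig (Fin 5)),
      spinAt 0 (ω * Pi.mulSingle (Fin.natAdd 2 j) (-1)) = spinAt 0 ω :=
    fun j ω => pcm2im_spinAt_flip_ne (k23_mid_ne_zero j).symm ω
  have h1 : ∀ (j : Fin 3) (ω : SpinConfig (Fin 5)),
      spinAt 1 (ω * Pi.mulSingle (Fin.natAdd 2 j) (-1)) = spinAt 1 ω :=
    fun j ω => pcm2im_spinAt_flip_ne (k23_mid_ne_one j).symm ω
  rw [hlin, k23_decimate b c _ (fun j ω => by rw [h0, h1])]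
  have hch : ∀ (j : Fin 3) (ω : SpinConfig (Fin 5)), Real.cosh (b j * spinAt 0 ω + c j * spinAt 1 ω)
      = Real.cosh (b j) * Real.cosh (c j) / Real.cosh (a j) * Real.exp (spinAt 0 ω * spinAt 1 ω * a j) :=
    fun j ω => k23_cosh_branch (habc j) _ _ (spinAt_eq_one_or_eq_neg_one 0 ω)
      (spinAt_eq_one_or_eq_neg_one 1 ω)
  have hk : (1 - Real.tanh (∑ i, a i)) * (Real.exp (a 0) * Real.exp (a 1) * Real.exp (a 2))
      = (1 + Real.tanh (∑ i, a i)) * (Real.exp (-a 0) * Real.exp (-a 1) * Real.exp (-a 2)) := by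
    have e1 : Real.exp (a 0) * Real.exp (a 1) * Real.exp (a 2) = Real.exp (∑ i, a i) := by
      rw [Fin.sum_univ_three, Real.exp_add, Real.exp_add]
    have e2 : Real.exp (-a 0) * Real.exp (-a 1) * Real.exp (-a 2) = Real.exp (-∑ i, a i) := by
      rw [Fin.sum_univ_three, ← Real.exp_add, ← Real.exp_add]
      congr 1
      ring
    rw [e1, e2]
    exact c2_tanh_key _
  have h10 : (1 : Fin 5) ≠ 0 := by decide
  refine c2_sum_flip_zero 0 _ fun ω => ?_
  rw [hch, hch, hch, hch, hch, hch]
  simp only [pcm2im_spinAt_flip_same, pcm2im_spinAt_flip_ne h10]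
  rcases spinAt_eq_one_or_eq_neg_one 0 ω with e0 | e0 <;>
    rcases spinAt_eq_one_or_eq_neg_one 1 ω with e1 | e1 <;> rw [e0, e1] <;>
    simp only [mul_one, one_mul, mul_neg_one, neg_one_mul, neg_neg] <;>
    linear_combination (Real.cosh (b 0) * Real.cosh (c 0) / Real.cosh (a 0))
      * (Real.cosh (b 1) * Real.cosh (c 1) / Real.cosh (a 1))
      * (Real.cosh (b 2) * Real.cosh (c 2) / Real.cosh (a 2)) * hk

/-- Registered helper `helper_k23_rho` (representative of this auxiliary file): for the `K₂,₃` pair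
ferromagnet, `⟨σ₀σ₁⟩ = tanh (∑ a_i)` when `tanh a_i = tanh b_i · tanh c_i` (`k23_rho`). [folklore] -/
theorem helper_k23_rho : ∀ (b c a : Fin 3 → ℝ), (∀ i, Real.tanh (a i) = Real.tanh (b i) * Real.tanh (c i)) → gksExpect (Finset.univ : Finset (Fin 3 ⊕ Fin 3)) (Sum.elim b c) (Sum.elim (fun i : Fin 3 => ({0, Fin.natAdd 2 i} : Finset (Fin 5))) (fun i : Fin 3 => ({1, Fin.natAdd 2 i} : Finset (Fin 5)))) (fun ω => spinAt 0 ω * spinAt 1 ω) = Real.tanh (∑ i, a i) :=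
  fun b c a habc => k23_rho b c a habc

end

end Summit.CriticalPhenomena.Ising3DConformalLimit.Cruxes.InverseMFerromagnet.PartialCovarianceLadder
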